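import Summits.Parity.BatemanHorn.Theorems.AlmostPrimeZerosLinearCappedRepulsionCappedEulerData
import Literature.NumberTheory.Sieve.GoldstonPintzYildirimEulerProduct
import HarnessLib

/-!
# The capped Euler product as Selberg–Delange data on `σ > 1 − 1/(4(R+1))` (stub `stub_cappedEulerDataSharp`)

Crux stmt-Parity-17114 (`Summit.Parity.BatemanHorn.Theses.AlmostPrimeZeros.DiscMajorantLog`), line
`Sketch`, wave 3, stub E1.  For `a_z(n) = z^{s(n)}`, `s(n) = Σ_{p^v ∥ n} min(v, 2)`, and Selberg's factors
`E_p(s, z) = (1 + z q + z² q²/(1 − q)) exp(z Log(1 − q))`, `q = p^{-s}`, the tree file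
`AlmostPrimeZerosLinearCappedRepulsionCappedEulerData.lean` gives `RieszData R (4/5) (exp(b (1+R)^{3/2})) …`
for `F(s, z) = ∏_p E_p(s, z)` (the `3/2` is forced by bounding `F` on `σ > 4/5`).  Here the two norm
bounds are re-done on the THIN half-plane `σ > σ₁ = 1 − 1/(4(R+1))` with budget `exp(b (1+R) log(R+2))`
(holomorphy, `Σ z^{s(n)} n^{-s} = ζ(s)^z F(s, z)` and locally uniform convergence are imported):

* `norm_tprod_factor_le_sharp` — `‖F(s, z)‖ ≤ exp(99 (1+R) log(R+2))` for `σ > σ₁`, `‖z‖ ≤ R`: with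
  `δ = 1/(4(R+1))`, an integer `8R < N ≤ 8(R+1)` (`N^δ ≤ 2`) and `‖p^{-s}‖ ≤ p^{δ−1}`, the primes
  `p ≤ N` are bounded crudely (`‖E_p‖ ≤ (R+2)³ e^{(5/2) R ‖p^{-s}‖}`, `‖p^{-s}‖ ≤ 2/p`, harmonic sum),
  the primes `p > N` by the quadratic closeness `‖E_p − 1‖ ≤ 20(R+R²)‖p^{-s}‖²` (`R‖p^{-s}‖ ≤ 1/4`)
  and the tail `Σ_{p>N} p^{2δ−2} ≤ N^{2δ−1}/(1−2δ) ≤ 8/N`;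
* `tsum_norm_term_le_sharp` — `Σ ‖a_z(n)‖ n^{-σ} ≤ e^{100(1+R)log(R+2)} (σ − 1)^{-R}` for `1 < σ ≤ 2`;
* **`stub_cappedEulerDataSharp`**: `RieszData R (1 − 1/(4(R+1))) (exp(100 (1+R) log(R+2))) z a_z F(·, z)`.

Theorem-only file.  References: H. L. Montgomery, R. C. Vaughan, *Multiplicative Number Theory I*,
CUP 2007, §7.4 (Theorem 7.18, (7.60)); G. Tenenbaum, *Introduction to analytic and probabilistic number
theory*, 3rd ed., II.5 §5.1.
-/

noncomputable section

open Complex LSeries Filter Topology Finset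
open Literature.NumberTheory.LFunctions Literature.NumberTheory.LFunctions.SelbergDelangeCapped
open Summit.Parity.BatemanHorn.Cruxes.LinearCappedRepulsion.JensenStieltjesMajorant

namespace Summit.Parity.BatemanHorn.Cruxes.DiscMajorantLog.Sketch

namespace CappedEulerSharp

/-! ### Two bounds for one factor `E(q, z)` (`‖q‖ ≤ 3/4`, `‖z‖ ≤ R`) -/

/-- **Crude bound**: for `‖q‖ ≤ 3/4` and `‖z‖ ≤ R`,
`‖(1 + z q + z² q²/(1 − q)) exp(z Log(1 − q))‖ ≤ exp(3 log(R+2) + (5/2) R ‖q‖)`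
(`‖1 + zq + z²q²/(1−q)‖ ≤ 1 + R + 4R² ≤ (R+2)³` and `‖Log(1 − q)‖ ≤ 5‖q‖/2`). -/
theorem norm_capFactor_le_crude {q z : ℂ} {R : ℝ} (hq : ‖q‖ ≤ 3 / 4) (hz : ‖z‖ ≤ R) :
    ‖(1 + z * q + z ^ 2 * q ^ 2 / (1 - q)) * exp (z * log (1 - q))‖ ≤
      Real.exp (3 * Real.log (R + 2) + 5 / 2 * R * ‖q‖) := by
  set t : ℝ := ‖q‖ with ht
  set r : ℝ := ‖z‖ with hr
  have ht0 : 0 ≤ t := norm_nonneg _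
  have hr0 : 0 ≤ r := norm_nonneg _
  have hR : 0 ≤ R := hr0.trans hz
  have hrt : r * t ≤ R := by nlinarith
  have h1q : 1 / 4 ≤ ‖1 - q‖ := by
    have := norm_sub_norm_le (1 : ℂ) q
    rw [norm_one] at this
    linarith
  have hrat : ‖1 + z * q + z ^ 2 * q ^ 2 / (1 - q)‖ ≤ (R + 2) ^ 3 := by
    have hB : ‖z ^ 2 * q ^ 2 / (1 - q)‖ ≤ 4 * (r * t) ^ 2 := by
      rw [norm_div, norm_mul, norm_pow, norm_pow, div_le_iff₀ (by linarith), ← hr, ← ht]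
      nlinarith [sq_nonneg (r * t)]
    have h2 : (r * t) ^ 2 ≤ R ^ 2 := pow_le_pow_left₀ (mul_nonneg hr0 ht0) hrt 2
    calc ‖1 + z * q + z ^ 2 * q ^ 2 / (1 - q)‖
        ≤ ‖(1 : ℂ)‖ + ‖z * q‖ + ‖z ^ 2 * q ^ 2 / (1 - q)‖ := norm_add₃_le
      _ ≤ 1 + r * t + 4 * (r * t) ^ 2 := by rw [norm_one, norm_mul]; linarith
      _ ≤ (R + 2) ^ 3 := by nlinarith [pow_nonneg hR 3, sq_nonneg R]
  have hnq : ‖-q‖ < 1 := by rw [norm_neg]; linarith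
  have hlog : ‖log (1 - q)‖ ≤ 5 / 2 * t := by
    have h := norm_log_one_add_le hnq
    rw [norm_neg, ← sub_eq_add_neg] at h
    have h2 : (1 - t)⁻¹ ≤ 4 := by
      rw [inv_le_comm₀ (by linarith) (by norm_num)]; linarith
    calc ‖log (1 - q)‖ ≤ t ^ 2 * (1 - t)⁻¹ / 2 + t := h
      _ ≤ t ^ 2 * 4 / 2 + t := by gcongr
      _ ≤ 5 / 2 * t := by nlinarith
  have hexpf : ‖exp (z * log (1 - q))‖ ≤ Real.exp (5 / 2 * R * t) := by
    refine (norm_exp_le_exp_norm _).trans (Real.exp_le_exp.2 ?_)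
    rw [norm_mul, ← hr]
    calc r * ‖log (1 - q)‖ ≤ R * (5 / 2 * t) := mul_le_mul hz hlog (norm_nonneg _) hR
      _ = 5 / 2 * R * t := by ring
  have h3 : Real.exp (3 * Real.log (R + 2)) = (R + 2) ^ 3 := by
    rw [show (3 : ℝ) * Real.log (R + 2) = Real.log ((R + 2) ^ 3) by
      rw [Real.log_pow]; push_cast; ring, Real.exp_log (by positivity)]
  rw [norm_mul, Real.exp_add, h3]
  exact mul_le_mul hrat hexpf (norm_nonneg _) (by positivity)

/-- **Quadratic bound**: for `‖q‖ ≤ 3/4`, `‖z‖ ≤ R` and `R‖q‖ ≤ 1/4`,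
`‖(1 + z q + z² q²/(1 − q)) exp(z Log(1 − q))‖ ≤ exp(20 (R + R²) ‖q‖²)` (the tree's quadratic
closeness `norm_capFactor_sub_one_le` and `1 + x ≤ eˣ`). -/
theorem norm_capFactor_le_quad {q z : ℂ} {R : ℝ} (hq : ‖q‖ ≤ 3 / 4) (hz : ‖z‖ ≤ R)
    (hRq : R * ‖q‖ ≤ 1 / 4) :
    ‖(1 + z * q + z ^ 2 * q ^ 2 / (1 - q)) * exp (z * log (1 - q))‖ ≤
      Real.exp (20 * (R + R ^ 2) * ‖q‖ ^ 2) := by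
  have hr0 : 0 ≤ ‖z‖ := norm_nonneg _
  have hzq : ‖z‖ * ‖q‖ ≤ 1 / 4 := (mul_le_mul_of_nonneg_right hz (norm_nonneg _)).trans hRq
  have h1 := norm_capFactor_sub_one_le hq hzq
  have h2 : 20 * (‖z‖ + ‖z‖ ^ 2) * ‖q‖ ^ 2 ≤ 20 * (R + R ^ 2) * ‖q‖ ^ 2 := by gcongr
  calc ‖(1 + z * q + z ^ 2 * q ^ 2 / (1 - q)) * exp (z * log (1 - q))‖
      = ‖1 + ((1 + z * q + z ^ 2 * q ^ 2 / (1 - q)) * exp (z * log (1 - q)) - 1)‖ := by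
        rw [add_sub_cancel]
    _ ≤ ‖(1 : ℂ)‖ + ‖(1 + z * q + z ^ 2 * q ^ 2 / (1 - q)) * exp (z * log (1 - q)) - 1‖ :=
        norm_add_le _ _
    _ ≤ 20 * (R + R ^ 2) * ‖q‖ ^ 2 + 1 := by rw [norm_one]; linarith
    _ ≤ Real.exp (20 * (R + R ^ 2) * ‖q‖ ^ 2) := Real.add_one_le_exp _

/-! ### The cut `N ≤ 8(R+1)` and sums over the primes of a finite set -/

/-- For `0 < N ≤ 8(R + 1)`, `R ≥ 0`: `log N ≤ 3 log 2 + log(R + 1)` and `N^{1/(4(R+1))} ≤ 2`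
(`3 log 2 + log(R+1) ≤ 3 log 2 + R ≤ 4 (R + 1) log 2`). -/
theorem log_le_and_rpow_le_two {R N : ℝ} (hR : 0 ≤ R) (hN0 : 0 < N) (hN : N ≤ 8 * (R + 1)) :
    Real.log N ≤ 3 * Real.log 2 + Real.log (R + 1) ∧ N ^ (1 / (4 * (R + 1))) ≤ 2 := by
  have hlogN : Real.log N ≤ 3 * Real.log 2 + Real.log (R + 1) := by
    calc Real.log N ≤ Real.log (8 * (R + 1)) := Real.log_le_log hN0 hN
      _ = Real.log (2 ^ 3) + Real.log (R + 1) := by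
          rw [Real.log_mul (by norm_num) (ne_of_gt (by linarith))]; norm_num
      _ = 3 * Real.log 2 + Real.log (R + 1) := by rw [Real.log_pow]; push_cast; ring
  have hl2 := Real.log_two_gt_d9
  have hR1 := Real.log_le_sub_one_of_pos (by linarith : (0 : ℝ) < R + 1)
  refine ⟨hlogN, ?_⟩
  rw [Real.rpow_def_of_pos hN0]
  refine (Real.exp_le_exp.2 ?_).trans (Real.exp_log two_pos).le
  rw [mul_one_div, div_le_iff₀ (by positivity)]
  nlinarith [mul_nonneg hR (by linarith : (0 : ℝ) ≤ 4 * Real.log 2 - 1)]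

/-- A nonnegative `f` summed over the primes `p ∈ T` with `P p` is at most its sum over any finite set
`S` of naturals containing them (push `T` into `ℕ` along the injection `Nat.Primes → ℕ`). -/
theorem sum_filter_le_sum (T : Finset Nat.Primes) (P : Nat.Primes → Prop) [DecidablePred P]
    (S : Finset ℕ) (hS : ∀ p ∈ T, P p → (p : ℕ) ∈ S) {f : ℕ → ℝ} (hf : ∀ n, 0 ≤ f n) :
    ∑ p ∈ T.filter P, f p ≤ ∑ n ∈ S, f n := by
  set e : Nat.Primes ↪ ℕ := ⟨(↑), Nat.Primes.coe_nat_injective⟩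
  have h1 : ∑ p ∈ T.filter P, f p = ∑ n ∈ (T.filter P).map e, f n := by
    rw [Finset.sum_map]; rfl
  rw [h1]
  refine Finset.sum_le_sum_of_subset_of_nonneg (fun n hn ↦ ?_) fun n _ _ ↦ hf n
  rw [Finset.mem_map] at hn
  obtain ⟨p, hp, rfl⟩ := hn
  exact hS p (Finset.mem_filter.1 hp).1 (Finset.mem_filter.1 hp).2

/-! ### The explicit bound for `F(s, z)` on `σ > 1 − 1/(4(R+1))` and the majorant -/

/-- **The explicit bound for `F` on the thin half-plane**: for `R ≥ 0`, `σ > 1 − 1/(4(R+1))` and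
`‖z‖ ≤ R`, `‖F(s, z)‖ ≤ exp(99 (1 + R) log(R + 2))`.  With `δ = 1/(4(R+1))`, an integer
`8R < N ≤ 8(R+1)` (`N^δ ≤ 2`) and `‖p^{-s}‖ ≤ p^{δ−1}`: the primes `p ≤ N` have `‖p^{-s}‖ ≤ 2/p`,
`‖E_p‖ ≤ exp(3 log(R+2) + 5R/p)`, in total `≤ exp(24(R+1)log(R+2) + 5R(1 + log N))`; the primes
`p > N` have `R‖p^{-s}‖ ≤ 2R/N ≤ 1/4`, `‖E_p‖ ≤ exp(20(R+R²) p^{2δ−2})`, and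
`Σ_{p>N} p^{2δ−2} ≤ N^{2δ−1}/(1−2δ) ≤ 8/N`, in total `≤ exp(20(1+R))`. -/
theorem norm_tprod_factor_le_sharp {s z : ℂ} {R : ℝ} (hR : 0 ≤ R)
    (hs : 1 - 1 / (4 * (R + 1)) < s.re) (hz : ‖z‖ ≤ R) :
    ‖∏' p : Nat.Primes, (1 + z * (p : ℂ) ^ (-s) + z ^ 2 * ((p : ℂ) ^ (-s)) ^ 2 /
        (1 - (p : ℂ) ^ (-s))) * exp (z * log (1 - (p : ℂ) ^ (-s)))‖ ≤
      Real.exp (99 * (1 + R) * Real.log (R + 2)) := by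
  set E : Nat.Primes → ℂ := fun p ↦ (1 + z * (p : ℂ) ^ (-s) + z ^ 2 * ((p : ℂ) ^ (-s)) ^ 2 /
    (1 - (p : ℂ) ^ (-s))) * exp (z * log (1 - (p : ℂ) ^ (-s)))
  -- the parameters `δ` and `N`
  set δ : ℝ := 1 / (4 * (R + 1))
  have hδ0 : 0 < δ := by positivity
  have hδ1 : δ ≤ 1 / 4 := one_div_le_one_div_of_le (by norm_num) (by linarith)
  obtain ⟨N, hN8, hNR, hN88⟩ : ∃ N : ℕ, (N : ℝ) ≤ 8 * (R + 1) ∧ 8 * R < N ∧ 8 ≤ N :=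
    ⟨8 * (⌊R⌋₊ + 1), by push_cast; linarith [Nat.floor_le hR],
      by push_cast; linarith [Nat.lt_floor_add_one R], by omega⟩
  have hN1 : 1 ≤ N := by omega
  have hN8' : (8 : ℝ) ≤ N := by exact_mod_cast hN88
  have hN0 : (0 : ℝ) < N := by linarith
  obtain ⟨hlogN, hNδ⟩ := log_le_and_rpow_le_two hR hN0 hN8
  have hlog0 : 0 ≤ Real.log (R + 2) := Real.log_nonneg (by linarith)
  have hL2 : Real.log 2 ≤ Real.log (R + 2) := Real.log_le_log two_pos (by linarith)
  have hl2 := Real.log_two_gt_d9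
  -- `‖p^{-s}‖ ≤ p^{δ-1}` and `‖p^{-s}‖ ≤ 3/4`
  have ht : ∀ p : Nat.Primes, ‖(p : ℂ) ^ (-s)‖ ≤ ((p : ℕ) : ℝ) ^ (δ - 1) := fun p ↦ by
    rw [SatheSelberg.norm_primes_cpow_neg]
    exact Real.rpow_le_rpow_of_exponent_le (by exact_mod_cast p.prop.one_lt.le) (by linarith)
  have ht' : ∀ p : Nat.Primes, ‖(p : ℂ) ^ (-s)‖ ≤ 3 / 4 := fun p ↦
    CappedEuler.norm_primes_cpow_le p (by linarith)
  -- small primes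
  have hsmall : ∀ p : Nat.Primes, (p : ℕ) ≤ N →
      ‖E p‖ ≤ Real.exp (3 * Real.log (R + 2) + 5 * R * ((p : ℕ) : ℝ)⁻¹) := by
    intro p hp
    have hp0 : (0 : ℝ) < (p : ℕ) := by exact_mod_cast p.prop.pos
    have h2 : ‖(p : ℂ) ^ (-s)‖ ≤ 2 * ((p : ℕ) : ℝ)⁻¹ := by
      calc ‖(p : ℂ) ^ (-s)‖ ≤ ((p : ℕ) : ℝ) ^ (δ - 1) := ht p
        _ = ((p : ℕ) : ℝ) ^ δ * ((p : ℕ) : ℝ)⁻¹ := by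
            rw [sub_eq_add_neg, Real.rpow_add hp0, Real.rpow_neg_one]
        _ ≤ (N : ℝ) ^ δ * ((p : ℕ) : ℝ)⁻¹ := by gcongr
        _ ≤ 2 * ((p : ℕ) : ℝ)⁻¹ := by gcongr
    refine (norm_capFactor_le_crude (ht' p) hz).trans (Real.exp_le_exp.2 ?_)
    nlinarith [mul_le_mul_of_nonneg_left h2 hR]
  -- large primes
  have hlarge : ∀ p : Nat.Primes, ¬(p : ℕ) ≤ N →
      ‖E p‖ ≤ Real.exp (20 * (R + R ^ 2) * ((p : ℕ) : ℝ) ^ (-(2 - 2 * δ))) := by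
    intro p hp
    have hNp : (N : ℝ) ≤ (p : ℕ) := by exact_mod_cast (not_le.1 hp).le
    have hp0 : (0 : ℝ) < (p : ℕ) := by linarith
    have hRt : R * ‖(p : ℂ) ^ (-s)‖ ≤ 1 / 4 := by
      have h1 : ‖(p : ℂ) ^ (-s)‖ ≤ 2 * (N : ℝ)⁻¹ := by
        calc ‖(p : ℂ) ^ (-s)‖ ≤ ((p : ℕ) : ℝ) ^ (δ - 1) := ht p
          _ ≤ (N : ℝ) ^ (δ - 1) := Real.rpow_le_rpow_of_nonpos hN0 hNp (by linarith)
          _ = (N : ℝ) ^ δ * (N : ℝ)⁻¹ := by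
              rw [sub_eq_add_neg, Real.rpow_add hN0, Real.rpow_neg_one]
          _ ≤ 2 * (N : ℝ)⁻¹ := by gcongr
      calc R * ‖(p : ℂ) ^ (-s)‖ ≤ R * (2 * (N : ℝ)⁻¹) := mul_le_mul_of_nonneg_left h1 hR
        _ = 2 * R / N := by ring
        _ ≤ 1 / 4 := by rw [div_le_iff₀ hN0]; linarith
    refine (norm_capFactor_le_quad (ht' p) hz hRt).trans (Real.exp_le_exp.2 ?_)
    refine mul_le_mul_of_nonneg_left ?_ (by positivity)
    calc ‖(p : ℂ) ^ (-s)‖ ^ 2 ≤ (((p : ℕ) : ℝ) ^ (δ - 1)) ^ 2 :=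
          pow_le_pow_left₀ (norm_nonneg _) (ht p) 2
      _ = ((p : ℕ) : ℝ) ^ (-(2 - 2 * δ)) := by
          rw [← Real.rpow_natCast, ← Real.rpow_mul hp0.le]; congr 1; push_cast; ring
  -- the bound for every finite product, split at `N`
  obtain ⟨σ₀, h1, h2⟩ := exists_between (by linarith : 1 / 2 < s.re)
  refine hasProd_le_of_prod_le ((CappedEuler.hasProdLocallyUniformlyOn_factor z h1).hasProd h2).norm
    fun T ↦ ?_
  have hA : ∏ p ∈ T.filter (fun p : Nat.Primes ↦ (p : ℕ) ≤ N), ‖E p‖ ≤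
      Real.exp (24 * (R + 1) * Real.log (R + 2) + 5 * R * (1 + Real.log N)) := by
    have hf0 : ∀ n : ℕ, 0 ≤ 3 * Real.log (R + 2) + 5 * R * (n : ℝ)⁻¹ := fun n ↦
      add_nonneg (mul_nonneg (by norm_num) hlog0)
        (mul_nonneg (mul_nonneg (by norm_num) hR) (inv_nonneg.2 (Nat.cast_nonneg n)))
    calc ∏ p ∈ T.filter (fun p : Nat.Primes ↦ (p : ℕ) ≤ N), ‖E p‖
        ≤ ∏ p ∈ T.filter (fun p : Nat.Primes ↦ (p : ℕ) ≤ N),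
            Real.exp (3 * Real.log (R + 2) + 5 * R * ((p : ℕ) : ℝ)⁻¹) :=
          Finset.prod_le_prod (fun p _ ↦ norm_nonneg _) fun p hp ↦
            hsmall p (Finset.mem_filter.1 hp).2
      _ = Real.exp (∑ p ∈ T.filter (fun p : Nat.Primes ↦ (p : ℕ) ≤ N),
            (3 * Real.log (R + 2) + 5 * R * ((p : ℕ) : ℝ)⁻¹)) := by rw [Real.exp_sum]
      _ ≤ Real.exp (∑ n ∈ Finset.Icc 1 N, (3 * Real.log (R + 2) + 5 * R * (n : ℝ)⁻¹)) :=
          Real.exp_le_exp.2 (sum_filter_le_sum T _ (Finset.Icc 1 N)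
            (fun p _ hp ↦ Finset.mem_Icc.2 ⟨p.prop.one_lt.le, hp⟩)
            (f := fun n : ℕ ↦ 3 * Real.log (R + 2) + 5 * R * (n : ℝ)⁻¹) hf0)
      _ ≤ Real.exp (24 * (R + 1) * Real.log (R + 2) + 5 * R * (1 + Real.log N)) := by
          rw [Real.exp_le_exp, Finset.sum_add_distrib, Finset.sum_const, Nat.card_Icc,
            add_tsub_cancel_right, nsmul_eq_mul, ← Finset.mul_sum]
          -- the harmonic sum `Σ_{n ≤ N} 1/n ≤ 1 + log N`
          have hH := harmonic_le_one_add_log N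
          rw [harmonic_eq_sum_Icc] at hH
          push_cast at hH
          nlinarith [mul_le_mul_of_nonneg_right hN8 hlog0, mul_le_mul_of_nonneg_left hH hR]
  have hB : ∏ p ∈ T.filter (fun p : Nat.Primes ↦ ¬(p : ℕ) ≤ N), ‖E p‖ ≤
      Real.exp (20 * (1 + R)) := by
    calc ∏ p ∈ T.filter (fun p : Nat.Primes ↦ ¬(p : ℕ) ≤ N), ‖E p‖
        ≤ ∏ p ∈ T.filter (fun p : Nat.Primes ↦ ¬(p : ℕ) ≤ N),
            Real.exp (20 * (R + R ^ 2) * ((p : ℕ) : ℝ) ^ (-(2 - 2 * δ))) :=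
          Finset.prod_le_prod (fun p _ ↦ norm_nonneg _) fun p hp ↦
            hlarge p (Finset.mem_filter.1 hp).2
      _ = Real.exp (20 * (R + R ^ 2) * ∑ p ∈ T.filter (fun p : Nat.Primes ↦ ¬(p : ℕ) ≤ N),
            ((p : ℕ) : ℝ) ^ (-(2 - 2 * δ))) := by rw [Finset.mul_sum, Real.exp_sum]
      _ ≤ Real.exp (20 * (1 + R)) := by
          rw [Real.exp_le_exp]
          have htail := (sum_filter_le_sum T _ (Finset.Ioc N (T.sup fun p ↦ (p : ℕ)))
            (fun p hp hpN ↦ Finset.mem_Ioc.2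
              ⟨not_le.1 hpN, Finset.le_sup (f := fun p : Nat.Primes ↦ (p : ℕ)) hp⟩)
            (f := fun n : ℕ ↦ (n : ℝ) ^ (-(2 - 2 * δ))) fun n ↦ Real.rpow_nonneg n.cast_nonneg _).trans
            (Literature.NumberTheory.Sieve.GPY.sum_Ioc_rpow_neg_le hN1 (by linarith : 1 < 2 - 2 * δ))
          have hpow : (N : ℝ) ^ (1 - (2 - 2 * δ)) ≤ 4 * (N : ℝ)⁻¹ := by
            rw [show 1 - (2 - 2 * δ) = δ * 2 + (-1) by ring, Real.rpow_add hN0,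
              Real.rpow_mul hN0.le, Real.rpow_neg_one, Real.rpow_two]
            have h4 : ((N : ℝ) ^ δ) ^ 2 ≤ 4 := by nlinarith [Real.rpow_nonneg hN0.le δ]
            gcongr
          have h8 : (N : ℝ) ^ (1 - (2 - 2 * δ)) / (2 - 2 * δ - 1) ≤ 8 * (N : ℝ)⁻¹ := by
            rw [div_le_iff₀ (by linarith)]
            nlinarith [mul_nonneg (inv_nonneg.2 hN0.le) (by linarith : (0 : ℝ) ≤ 1 / 4 - δ)]
          have hRN : R * (N : ℝ)⁻¹ ≤ 1 / 8 := by
            rw [← div_eq_mul_inv, div_le_iff₀ hN0]; linarith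
          calc 20 * (R + R ^ 2) * ∑ p ∈ T.filter (fun p : Nat.Primes ↦ ¬(p : ℕ) ≤ N),
                ((p : ℕ) : ℝ) ^ (-(2 - 2 * δ))
              ≤ 20 * (R + R ^ 2) * (8 * (N : ℝ)⁻¹) :=
                mul_le_mul_of_nonneg_left (htail.trans h8) (by positivity)
            _ = 160 * (R * (N : ℝ)⁻¹) * (1 + R) := by ring
            _ ≤ 160 * (1 / 8) * (1 + R) := by gcongr
            _ = 20 * (1 + R) := by ring
  rw [← Finset.prod_filter_mul_prod_filter_not T (fun p : Nat.Primes ↦ (p : ℕ) ≤ N)]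
  refine (mul_le_mul hA hB (Finset.prod_nonneg fun p _ ↦ norm_nonneg _)
    (Real.exp_nonneg _)).trans ?_
  rw [← Real.exp_add, Real.exp_le_exp]
  have hR12 : Real.log (R + 1) ≤ Real.log (R + 2) := Real.log_le_log (by linarith) (by linarith)
  have hlogN' : Real.log N ≤ 4 * Real.log (R + 2) := by linarith
  nlinarith [mul_le_mul_of_nonneg_left hlogN' hR,
    mul_nonneg hR (by linarith : (0 : ℝ) ≤ 2 * Real.log (R + 2) - 1)]

/-- **The majorant** on `1 < σ ≤ 2`: for `‖z‖ ≤ R`,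
`Σ ‖z^{s(n)} n^{-σ}‖ = ζ(σ)^{|z|} F(σ, |z|) ≤ (σ/(σ−1))^{R} e^{99(1+R)log(R+2)} ≤ e^{100(1+R)log(R+2)} (σ−1)^{-R}`
(`ζ(σ) ≤ σ/(σ−1)`, `σ^R ≤ 2^R ≤ e^{(1+R) log(R+2)}`; the real point `σ > 1 > 1 − 1/(4(R+1))`). -/
theorem tsum_norm_term_le_sharp {z : ℂ} {R σ : ℝ} (hz : ‖z‖ ≤ R) (hσ : 1 < σ) (hσ2 : σ ≤ 2) :
    ∑' n, ‖term (fun n : ℕ ↦ z ^ (n.factorization.sum fun _ v => min v 2)) σ n‖ ≤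
      Real.exp (100 * (1 + R) * Real.log (R + 2)) / (σ - 1) ^ R := by
  set a : ℂ → ℕ → ℂ := fun w n ↦ w ^ (n.factorization.sum fun _ v => min v 2) with ha
  change ∑' n, ‖term (a z) σ n‖ ≤ _
  have hr0 : 0 ≤ ‖z‖ := norm_nonneg _
  have hR : 0 ≤ R := hr0.trans hz
  have hσ' : 1 < (σ : ℂ).re := by simpa using hσ
  have hσ1 : 0 < σ - 1 := by linarith
  -- `‖a_z(n) n^{-σ}‖ = ‖a_r(n) n^{-σ}‖ = a_r(n) n^{-σ}` (`r = |z|`)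
  have hnorm : ∀ n, ‖term (a z) (σ : ℂ) n‖ = ‖term (a (‖z‖ : ℂ)) (σ : ℂ) n‖ := fun n ↦ by
    simp only [ha, norm_term_eq, norm_pow, Complex.norm_real, Real.norm_of_nonneg hr0]
  have hterm : ∀ n, term (a (‖z‖ : ℂ)) (σ : ℂ) n = ((‖term (a (‖z‖ : ℂ)) (σ : ℂ) n‖ : ℝ) : ℂ) := by
    intro n
    rcases eq_or_ne n 0 with rfl | hn
    · simp
    simp only [ha, term_of_ne_zero hn]
    rw [norm_div, norm_pow, Complex.norm_real, Real.norm_of_nonneg hr0,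
      norm_natCast_cpow_of_pos (Nat.pos_of_ne_zero hn), ofReal_re, ofReal_div, ofReal_pow,
      ofReal_cpow (Nat.cast_nonneg _), ofReal_natCast]
  have hL : LSeries (a (‖z‖ : ℂ)) (σ : ℂ) = ((∑' n, ‖term (a (‖z‖ : ℂ)) (σ : ℂ) n‖ : ℝ) : ℂ) := by
    rw [LSeries, ofReal_tsum]
    exact tsum_congr hterm
  have heq : ∑' n, ‖term (a z) (σ : ℂ) n‖ = ‖LSeries (a (‖z‖ : ℂ)) (σ : ℂ)‖ := by
    rw [hL, Complex.norm_real, Real.norm_of_nonneg (tsum_nonneg fun n ↦ norm_nonneg _)]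
    exact tsum_congr hnorm
  rw [heq, ha, CappedEuler.LSeries_eq (‖z‖ : ℂ) hσ', norm_mul]
  -- `‖ζ(σ)^r‖ ≤ (σ/(σ-1))^r ≤ (σ/(σ-1))^R ≤ 2^R/(σ-1)^R`
  have hpos : 0 < σ / (σ - 1) := div_pos (by linarith) hσ1
  have hone : 1 ≤ σ / (σ - 1) := (one_le_div hσ1).2 (by linarith)
  have hzeta : ‖SelbergDelange.zetaPow (‖z‖ : ℂ) (σ : ℂ)‖ ≤ 2 ^ R / (σ - 1) ^ R := by
    rw [SelbergDelange.zetaPow_eq_exp_eulerLogZeta _ hσ', norm_exp, re_ofReal_mul]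
    calc Real.exp (‖z‖ * (eulerLogZeta σ).re) ≤ Real.exp (‖z‖ * Real.log (σ / (σ - 1))) := by
          rw [Real.exp_le_exp]
          refine mul_le_mul_of_nonneg_left ?_ hr0
          calc (eulerLogZeta σ).re ≤ ‖eulerLogZeta σ‖ := re_le_norm _
            _ ≤ Real.log ((σ : ℂ).re / ((σ : ℂ).re - 1)) := SatheSelberg.norm_eulerLogZeta_le hσ'
            _ = Real.log (σ / (σ - 1)) := by simp
      _ = (σ / (σ - 1)) ^ ‖z‖ := by rw [Real.rpow_def_of_pos hpos, mul_comm]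
      _ ≤ (σ / (σ - 1)) ^ R := Real.rpow_le_rpow_of_exponent_le hone hz
      _ = σ ^ R / (σ - 1) ^ R := Real.div_rpow (by linarith) hσ1.le R
      _ ≤ 2 ^ R / (σ - 1) ^ R :=
          div_le_div_of_nonneg_right (Real.rpow_le_rpow (by linarith) hσ2 hR)
            (Real.rpow_nonneg hσ1.le R)
  -- `‖F(σ, r)‖ ≤ exp(99 (1+R) log(R+2))`
  have hrn : ‖(‖z‖ : ℂ)‖ ≤ R := by rwa [Complex.norm_real, Real.norm_of_nonneg hr0]
  have hδ0 : 0 < 1 / (4 * (R + 1)) := by positivity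
  have hF := norm_tprod_factor_le_sharp hR (s := (σ : ℂ)) (by simp only [ofReal_re]; linarith) hrn
  -- `2^R ≤ exp((1+R) log(R+2))`
  have h2R : (2 : ℝ) ^ R ≤ Real.exp ((1 + R) * Real.log (R + 2)) := by
    rw [Real.rpow_def_of_pos two_pos, Real.exp_le_exp]
    have hL2 : Real.log 2 ≤ Real.log (R + 2) := Real.log_le_log two_pos (by linarith)
    have hl0 : 0 ≤ Real.log 2 := Real.log_nonneg one_le_two
    nlinarith [mul_le_mul_of_nonneg_left hL2 hR]
  calc ‖SelbergDelange.zetaPow (‖z‖ : ℂ) (σ : ℂ)‖ * ‖∏' p : Nat.Primes, (1 + (‖z‖ : ℂ) * (p : ℂ) ^ (-(σ : ℂ)) +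
        (‖z‖ : ℂ) ^ 2 * ((p : ℂ) ^ (-(σ : ℂ))) ^ 2 / (1 - (p : ℂ) ^ (-(σ : ℂ)))) *
          exp ((‖z‖ : ℂ) * log (1 - (p : ℂ) ^ (-(σ : ℂ))))‖
      ≤ 2 ^ R / (σ - 1) ^ R * Real.exp (99 * (1 + R) * Real.log (R + 2)) :=
        mul_le_mul hzeta hF (norm_nonneg _)
          (div_nonneg (Real.rpow_nonneg zero_le_two R) (Real.rpow_nonneg hσ1.le R))
    _ ≤ Real.exp ((1 + R) * Real.log (R + 2)) / (σ - 1) ^ R *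
          Real.exp (99 * (1 + R) * Real.log (R + 2)) := by gcongr
    _ = Real.exp (100 * (1 + R) * Real.log (R + 2)) / (σ - 1) ^ R := by
        rw [div_mul_eq_mul_div, ← Real.exp_add]
        congr 1
        congr 1
        ring

end CappedEulerSharp

open CappedEulerSharp in
/-- **Stub E1 (capped Euler data, sharp half-plane), PROVED.**  There is `b ≥ 0` (namely `b = 100`)
such that for every `R ≥ 0`, `‖z‖ ≤ R`, the coefficients `a(n) = z^{s(n)}` satisfy the engine
hypotheses `RieszData R σ₁ B z a G` with `σ₁ = 1 − 1/(4(R+1))`, `B = exp(b(1+R)log(R+2))` and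
`G(s) = ∏_p (1 + z p^{−s} + z² p^{−2s}/(1 − p^{−s}))·exp(z Log(1 − p^{−s}))`: `G` is holomorphic on
`σ > 1/2 ⊇ {σ > σ₁}` with `‖G(s)‖ ≤ B` on `σ > σ₁` (`norm_tprod_factor_le_sharp`), `Σ a(n) n^{−s}`
converges absolutely and equals `zetaPow z s · G(s)` for `σ > 1`, and
`Σ ‖a(n)‖ n^{−σ} ≤ B (σ − 1)^{−R}` for `1 < σ ≤ 2` (`tsum_norm_term_le_sharp`). -/
theorem stub_cappedEulerDataSharp :
    ∃ b : ℝ, 0 ≤ b ∧ ∀ R : ℝ, 0 ≤ R → ∀ z : ℂ, ‖z‖ ≤ R → ∃ G : ℂ → ℂ,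
      Literature.NumberTheory.LFunctions.SelbergDelange.RieszData R (1 - 1 / (4 * (R + 1)))
        (Real.exp (b * (1 + R) * Real.log (R + 2))) z
        (fun n : ℕ => z ^ (n.factorization.sum fun _ v => min v 2)) G := by
  refine ⟨100, by norm_num, fun R hR z hz ↦ ⟨fun s ↦ ∏' p : Nat.Primes,
    (1 + z * (p : ℂ) ^ (-s) + z ^ 2 * ((p : ℂ) ^ (-s)) ^ 2 / (1 - (p : ℂ) ^ (-s))) *
      exp (z * log (1 - (p : ℂ) ^ (-s))), hz, CappedEuler.differentiableOn_tprod_factor z ?_,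
    fun s hs ↦ ?_, fun σ hσ ↦ ?_, fun s hs ↦ CappedEuler.LSeries_eq z hs,
    fun σ hσ hσ2 ↦ tsum_norm_term_le_sharp hz hσ hσ2⟩⟩
  · have : 1 / (4 * (R + 1)) ≤ 1 / 4 := one_div_le_one_div_of_le (by norm_num) (by linarith)
    linarith
  · refine (norm_tprod_factor_le_sharp hR hs hz).trans (Real.exp_le_exp.2 ?_)
    have : 0 ≤ (1 + R) * Real.log (R + 2) := mul_nonneg (by linarith) (Real.log_nonneg (by linarith))
    nlinarith
  · exact (summable_norm_term z (by simpa using hσ)).of_norm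

end Summit.Parity.BatemanHorn.Cruxes.DiscMajorantLog.Sketch

end
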